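import Literature.Probability.RandomPlanarGeometry.SAWBridgePatternRatio
import Literature.Probability.RandomPlanarGeometry.SAWKestenRelation
import Literature.Probability.RandomPlanarGeometry.SAWBridgeDivergence
import Literature.Probability.RandomPlanarGeometry.SAWBridgeUpperBound
import Literature.Probability.RandomPlanarGeometry.SAWBridgeRenewalLimit
import Literature.Probability.RandomPlanarGeometry.SAWBridgeTwoStepRate
import Literature.Probability.Process.RenewalTheorem
import Literature.Probability.Process.RenewalRatioSandwich
import Mathlib.Analysis.SpecialFunctions.Pow.Real
import Mathlib.Analysis.SpecialFunctions.Pow.Asymptotics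
import HarnessLib

/-!
# A rate for Madras–Slade Theorem 7.3.4 (d): `|b_{N+1}/b_N − μ| ≤ K / log N` on `ℤ^d`, `d ≥ 2`

Topic `Literature/Probability/RandomPlanarGeometry` (continues `SAWBridgeTwoStepRate.lean`,
`SAWBridgePatternRatio.lean`, `SAWKestenRelation.lean`; uses `Process/RenewalRatioSandwich.lean`).

Source: N. Madras, G. Slade, *The Self-Avoiding Walk* (1993), Theorem 7.3.4 (book p. 248; held text
`book:madras1993-self-avoiding-walk` p0261:L12–L20): "(d) `lim_{N→∞} b_{N+1}/b_N = μ`." Proof pp. 248–249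
(p0261:L21–p0262:L18) = (7.3.13) `b_{N+2}/b_N → μ²` + a lim inf / Fatou argument (7.3.14) on the renewal
equation (4.2.2) with Kesten's relation (4.2.4) — NO RATE in print; §7.5 (p. 255, p0268) prints Kesten's 1963
rates only for `c_N` ((7.5.1)) and `c_N(0,x)` ((7.5.2)) and says "(d) is essentially a special case of a ratio
limit theorem in renewal theory" (Orey 1971, qualitative). Tree: `MadrasSlade1993_thm734d` (the limit),
`exists_bridgeTwoStepRate` (the two-step rate `-K N^{-1/3} ≤ b_{N+2}/b_N − μ² ≤ K N^{-1/4}`).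

## What is new in this file (not in print)

* `kestenTail_le_inv_log` — the explicit Kesten tail `1 − Σ_{k≤m} λ_k μ^{-k} ≤ 1/(1 + ½ log(m/μ))`
  (`m ≥ μ`), from the conservation law (B.5) and `Σ_{n≤m} b_n μ^{-n} ≥ 1 + ½ log(m/μ)` ((3.1.14));
* **`bridgeRatio_rate_log (d) : ∃ K, ∀ N ≥ 2, |b_{N+1}/b_N − μ| ≤ K / log N`** on `ℤ^{d+2}` — the printed
  limit with a RATE, unconditional: the quantitative sandwich (`Renewal.ratio_sandwich_sharp`) at window
  length `T = ⌊N^{1/8}⌋` with the upper two-step rate as window control and the explicit Kesten tail as the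
  dropped mass; `bridgeRatio_rate_log_eventually` reads off the constant `μ(128μ + 64μK' + 64K')`;
* **`bridgeRatio_rate_limsup`** — the sharp-constant form: for every `α ∈ (0,1/4)`, `δ > 0`, `T₀ ≥ 1`,
  eventually `|b_{N+1}/b_N − μ| ≤ (2μ/(α E) + δ)/log N` with `E = Σ_{t<T₀} λ_{2t+1} μ^{-(2t+1)}` any odd
  partial sum of Kesten's masses (finite data; on `ℤ²`, `λ₁ = 1, λ₃ = 2`).
(Lane «pcv-sawmu» route R16; statements typed by a-idea-1, two-step rate by a-p6, proofs a-p5.)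
-/

noncomputable section

open Finset Filter Topology Literature.Probability.LatticeModels
open scoped BigOperators

namespace Literature.Probability.RandomPlanarGeometry.SAW.Zd

/-- `Σ_{1 ≤ k ≤ n} g k = Σ_{k < n} g (k+1)`. [folklore] -/
private theorem sum_Icc_one_eq_sum_range (g : ℕ → ℝ) (n : ℕ) :
    ∑ k ∈ Icc 1 n, g k = ∑ k ∈ range n, g (k + 1) := by
  induction n with
  | zero => simp
  | succ n ih => rw [Finset.sum_Icc_succ_top (by omega), ih, Finset.sum_range_succ]

/-! ### The explicit Kesten tail -/

/-- **The explicit Kesten tail**: `1 − Σ_{1≤k≤m} λ_k μ^{-k} ≤ 1/(1 + ½ log(m/μ))` for `m ≥ 1`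
with `μ ≤ m`. Proof: the conservation law (B.5) `Σ_{k≤m} T_k u_{m−k} = 1` (`u_n = b_n μ^{-n}`,
`T_k = 1 − Σ_{j≤k} λ_j μ^{-j}` antitone) gives `T_m · Σ_{n≤m} u_n ≤ 1`, and
`Σ_{n≤m} u_n = 1 + B⁺_m(1/μ) ≥ 1 + ½ log(m/μ)` (`half_log_le_sum_bridgeCount`).
[cite: MadrasSlade1993, eq. (4.2.4)–(4.2.5) (p. 91), Appendix B eq. (B.5), eq. (3.1.14)] -/
theorem kestenTail_le_inv_log (d : ℕ) [NeZero d] {m : ℕ} (hm : 1 ≤ m) (hμm : connectiveConstant d ≤ m) :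
    1 - ∑ k ∈ Icc 1 m, (irreducibleBridgeCount d k : ℝ) / connectiveConstant d ^ k ≤
      1 / (1 + Real.log ((m : ℝ) / connectiveConstant d) / 2) := by
  obtain ⟨m', rfl⟩ : ∃ m', m = m' + 1 := ⟨m - 1, by omega⟩
  set μ := connectiveConstant d with hμdef
  have hμ : 0 < μ := connectiveConstant_pos d
  set u : ℕ → ℝ := fun n => (bridgeCount d n : ℝ) / μ ^ n with hu
  set f : ℕ → ℝ := fun k => (irreducibleBridgeCount d k : ℝ) / μ ^ k with hf
  set r : ℕ → ℝ := fun n => 1 - ∑ k ∈ range (n + 1), f k with hrdef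
  have hr : ∀ n, r n = 1 - ∑ k ∈ range (n + 1), f k := fun n => rfl
  have hu0 : u 0 = 1 := bridgeCount_div_pow_zero d
  have hf0 : f 0 = 0 := irreducibleBridgeCount_div_pow_zero d
  have hren : ∀ n, 1 ≤ n → u n = ∑ k ∈ range (n + 1), f k * u (n - k) :=
    fun n hn => MadrasSlade1993_eq425 d hn
  have hB5 := _root_.Literature.Probability.Process.Renewal.sum_tailSum_mul_eq_one hr hu0 hf0 hren (m' + 1)
  -- `r` is antitone
  have hf_nonneg : ∀ k, 0 ≤ f k := irreducibleBridgeCount_div_pow_nonneg d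
  have hr_anti : Antitone r := by
    refine antitone_nat_of_succ_le fun n => ?_
    rw [_root_.Literature.Probability.Process.Renewal.tailSum_succ hr n]
    linarith [hf_nonneg (n + 1)]
  have hu_nonneg : ∀ n, 0 ≤ u n := bridgeCount_div_pow_nonneg d
  -- `r (m'+1) * Σ_{k ≤ m'+1} u (m'+1-k) ≤ 1`
  have h1 : r (m' + 1) * ∑ k ∈ range (m' + 1 + 1), u (m' + 1 - k) ≤ 1 := by
    rw [← hB5, Finset.mul_sum]
    refine Finset.sum_le_sum fun k hk => ?_
    have hk' : k ≤ m' + 1 := Nat.lt_succ_iff.1 (Finset.mem_range.1 hk)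
    exact mul_le_mul_of_nonneg_right (hr_anti hk') (hu_nonneg _)
  -- the sum is `1 + B⁺_{m'+1}(1/μ)`
  have h2 : ∑ k ∈ range (m' + 1 + 1), u (m' + 1 - k) = 1 + bridgeGFpos d (m' + 1) μ⁻¹ := by
    have hrefl : ∑ k ∈ range (m' + 1 + 1), u (m' + 1 - k) = ∑ k ∈ range (m' + 1 + 1), u k := by
      have := Finset.sum_range_reflect u (m' + 1 + 1)
      simpa using this
    rw [hrefl, bridgeGFpos, Finset.sum_range_succ',
      Finset.sum_range_succ' (fun n => if n = 0 then (0 : ℝ) else (bridgeCount d n : ℝ) * μ⁻¹ ^ n)]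
    simp only [Nat.succ_ne_zero, if_false, if_true, hu0, add_zero]
    rw [add_comm]
    congr 1
    refine Finset.sum_congr rfl fun n _ => ?_
    simp only [hu, inv_pow, div_eq_mul_inv]
  have h3 : Real.log ((m' + 1 : ℝ) / μ) / 2 ≤ bridgeGFpos d (m' + 1) μ⁻¹ :=
    half_log_le_sum_bridgeCount (d := d) m'
  have hlog0 : 0 ≤ Real.log (((m' + 1 : ℕ) : ℝ) / μ) := by
    refine Real.log_nonneg ?_
    rw [le_div_iff₀ hμ, one_mul]; exact hμm
  have hm1 : ((m' + 1 : ℕ) : ℝ) = (m' : ℝ) + 1 := by push_cast; ring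
  rw [hm1] at hlog0 ⊢
  have hU : 1 + Real.log (((m' : ℝ) + 1) / μ) / 2 ≤ ∑ k ∈ range (m' + 1 + 1), u (m' + 1 - k) := by
    rw [h2]; linarith
  have hUpos : 0 < 1 + Real.log (((m' : ℝ) + 1) / μ) / 2 := by linarith
  -- `r (m'+1) = LHS`
  have hrm : r (m' + 1) = 1 - ∑ k ∈ Icc 1 (m' + 1), f k := by
    rw [hr, Finset.sum_range_succ', hf0, add_zero, sum_Icc_one_eq_sum_range]
  rw [← hrm, le_div_iff₀ hUpos]
  calc r (m' + 1) * (1 + Real.log (((m' : ℝ) + 1) / μ) / 2)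
      ≤ r (m' + 1) * ∑ k ∈ range (m' + 1 + 1), u (m' + 1 - k) := by
        refine mul_le_mul_of_nonneg_left hU ?_
        have := hr_anti (Nat.zero_le (m' + 1))
        have hrlast : 0 ≤ r (m' + 1) := by
          rw [hr]
          have := sum_irreducibleBridgeCount_div_pow_le_one d (range (m' + 1 + 1))
          linarith
        exact hrlast
    _ ≤ 1 := h1

/-! ### Composition for bridges on `ℤ^{d+2}` -/

/-! The input: the two-step rate shapes `BridgeTwoStepRate d K N₀` (`-K N^{-1/3} ≤ b_{N+2}/b_N − μ² ≤ K N^{-1/4}`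
for `N ≥ N₀`) and `BridgeTwoStepUpperRate d K N₀` (`b_{N+2}/b_N ≤ μ²(1 + K N^{-1/4})`) of
`SAWBridgeTwoStepRate.lean`, where `exists_bridgeTwoStepRate d : ∃ K ≥ 0, ∃ N₀, BridgeTwoStepRate d K N₀` is
proved. -/

/-- The two-sided rate gives the upper rate with constant `K/μ²`.
[cite: MadrasSlade1993, Theorem 7.3.4 (d), eq. (7.3.13)] -/
theorem upperRate_of_rate {d : ℕ} {K : ℝ} {N₀ : ℕ} (h : BridgeTwoStepRate d K N₀) :
    BridgeTwoStepUpperRate d (K / connectiveConstant (d + 2) ^ 2) N₀ := by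
  intro N hN
  have hμ : 0 < connectiveConstant (d + 2) := connectiveConstant_pos (d + 2)
  have h2 := (h N hN).2
  have : connectiveConstant (d + 2) ^ 2 * (1 + K / connectiveConstant (d + 2) ^ 2 * (N : ℝ) ^ (-(1 : ℝ) / 4))
      = connectiveConstant (d + 2) ^ 2 + K * (N : ℝ) ^ (-(1 : ℝ) / 4) := by
    field_simp
  rw [this]; linarith

/-- Monotonicity of the upper rate in the constant.
[cite: MadrasSlade1993, Theorem 7.3.4 (d), eq. (7.3.13)] -/
theorem upperRate_mono {d : ℕ} {K K' : ℝ} {N₀ : ℕ} (h : BridgeTwoStepUpperRate d K N₀) (hKK' : K ≤ K') :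
    BridgeTwoStepUpperRate d K' N₀ := by
  intro N hN
  have hμ2 : 0 ≤ connectiveConstant (d + 2) ^ 2 := sq_nonneg _
  have hr : 0 ≤ (N : ℝ) ^ (-(1 : ℝ) / 4) := Real.rpow_nonneg (Nat.cast_nonneg N) _
  calc (bridgeCount (d + 2) (N + 2) : ℝ) / bridgeCount (d + 2) N
      ≤ connectiveConstant (d + 2) ^ 2 * (1 + K * (N : ℝ) ^ (-(1 : ℝ) / 4)) := h N hN
    _ ≤ connectiveConstant (d + 2) ^ 2 * (1 + K' * (N : ℝ) ^ (-(1 : ℝ) / 4)) := by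
        gcongr

section Bridges

variable (d : ℕ) [NeZero d]

/-- The renewal sequence `a_n = b_n μ^{-n}`.
[cite: MadrasSlade1993, §4.2, eq. (4.2.5) (p. 91)] -/
def renewalA (n : ℕ) : ℝ := (bridgeCount d n : ℝ) / connectiveConstant d ^ n

/-- Kesten's masses `p_k = λ_k μ^{-k}`.
[cite: MadrasSlade1993, §4.2, eq. (4.2.5) (p. 91)] -/
def renewalP (k : ℕ) : ℝ := (irreducibleBridgeCount d k : ℝ) / connectiveConstant d ^ k

/-- `a_n > 0` (`b_n ≥ 1`). [cite: MadrasSlade1993, §4.2 (p. 91)] -/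
theorem renewalA_pos (n : ℕ) : 0 < renewalA d n := by
  have hμ := connectiveConstant_pos d
  have hb : (1 : ℝ) ≤ bridgeCount d n := by exact_mod_cast one_le_bridgeCount (d := d) n
  unfold renewalA; positivity

/-- `p_k ≥ 0`. [cite: MadrasSlade1993, §4.2 (p. 91)] -/
theorem renewalP_nonneg (k : ℕ) : 0 ≤ renewalP d k := by
  have hμ := connectiveConstant_pos d
  unfold renewalP; positivity

/-- `p₁ = λ₁/μ ≥ 1/μ`.
[cite: MadrasSlade1993, §4.2 (p. 91); Theorem 4.2.2 (hypothesis f₁ > 0)] -/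
theorem inv_le_renewalP_one : (connectiveConstant d)⁻¹ ≤ renewalP d 1 := by
  have hμ := connectiveConstant_pos d
  have h1 : (1 : ℝ) ≤ irreducibleBridgeCount d 1 := by
    exact_mod_cast one_le_irreducibleBridgeCount_one (d := d)
  unfold renewalP
  rw [pow_one, inv_eq_one_div]
  exact div_le_div_of_nonneg_right h1 hμ.le

/-- The renewal equation (4.2.2)/(4.2.5) in the `Icc` shape of the sandwich.
[cite: MadrasSlade1993, §4.2, eq. (4.2.2)/(4.2.5) (p. 91)] -/
theorem renewalA_eq_sum (n : ℕ) (hn : 1 ≤ n) : renewalA d n = ∑ k ∈ Icc 1 n, renewalP d k * renewalA d (n - k) := by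
  have h := MadrasSlade1993_eq425 d hn
  rw [Finset.sum_range_succ'] at h
  have h0 : (irreducibleBridgeCount d 0 : ℝ) / connectiveConstant d ^ 0 = 0 :=
    irreducibleBridgeCount_div_pow_zero d
  rw [h0, zero_mul, add_zero] at h
  unfold renewalA renewalP
  rw [h, sum_Icc_one_eq_sum_range]

/-- Partial Kesten sums are `≤ 1`.
[cite: MadrasSlade1993, §4.2, eq. (4.2.4) (p. 91)] -/
theorem sum_renewalP_le_one (s : Finset ℕ) : ∑ k ∈ s, renewalP d k ≤ 1 :=
  sum_irreducibleBridgeCount_div_pow_le_one d s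

end Bridges

/-- The window control for bridges from the upper two-step rate: with `η = 2K n^{-1/4}`, for every `M`
in `[n − 2T − 1, n − 2]` (where `M ≥ n/2 ≥ N₀`), `a_{M+2} ≤ (1+η) a_M`.
[cite: MadrasSlade1993, Theorem 7.3.4 (d) (proof), eq. (7.3.13)] -/
theorem hup_bridges (d : ℕ) {K : ℝ} {N₀ : ℕ} (hK : 0 ≤ K) (hU : BridgeTwoStepUpperRate d K N₀)
    {n T : ℕ} (hwin : 2 * (2 * T + 1) ≤ n) (hN₀ : 2 * N₀ ≤ n) :
    ∀ M, n - (2 * T + 1) ≤ M → M + 2 ≤ n →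
      renewalA (d + 2) (M + 2) ≤ (1 + 2 * K * (n : ℝ) ^ (-(1 : ℝ) / 4)) * renewalA (d + 2) M := by
  intro M hM1 hM2
  have h2M : n ≤ 2 * M := by omega
  have hMN : N₀ ≤ M := by omega
  have hM0 : 1 ≤ M := by omega
  set μ := connectiveConstant (d + 2) with hμdef
  have hμ : 0 < μ := connectiveConstant_pos (d + 2)
  have hbM : (0 : ℝ) < bridgeCount (d + 2) M := by
    exact_mod_cast one_le_bridgeCount (d := d + 2) M
  -- `M^{-1/4} ≤ 2 n^{-1/4}`
  have hn0 : (0 : ℝ) < n := by exact_mod_cast (show 0 < n by omega)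
  have hMr : (n : ℝ) / 2 ≤ M := by
    have : (n : ℝ) ≤ 2 * M := by exact_mod_cast h2M
    linarith
  have hpow : (M : ℝ) ^ (-(1 : ℝ) / 4) ≤ 2 * (n : ℝ) ^ (-(1 : ℝ) / 4) := by
    have h1 : (M : ℝ) ^ (-(1 : ℝ) / 4) ≤ ((n : ℝ) / 2) ^ (-(1 : ℝ) / 4) :=
      Real.rpow_le_rpow_of_nonpos (by positivity) hMr (by norm_num)
    have h2 : ((n : ℝ) / 2) ^ (-(1 : ℝ) / 4) = (n : ℝ) ^ (-(1 : ℝ) / 4) / (2 : ℝ) ^ (-(1 : ℝ) / 4) :=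
      Real.div_rpow hn0.le (by norm_num) _
    have h3 : (1 / 2 : ℝ) ≤ (2 : ℝ) ^ (-(1 : ℝ) / 4) := by
      rw [show (-(1 : ℝ) / 4) = -((1 : ℝ) / 4) by ring, Real.rpow_neg (by norm_num), one_div]
      refine inv_anti₀ (by positivity) ?_
      calc (2 : ℝ) ^ ((1 : ℝ) / 4) ≤ (2 : ℝ) ^ (1 : ℝ) :=
            Real.rpow_le_rpow_of_exponent_le (by norm_num) (by norm_num)
        _ = 2 := Real.rpow_one 2
    have h4 : 0 ≤ (n : ℝ) ^ (-(1 : ℝ) / 4) := Real.rpow_nonneg hn0.le _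
    calc (M : ℝ) ^ (-(1 : ℝ) / 4) ≤ (n : ℝ) ^ (-(1 : ℝ) / 4) / (2 : ℝ) ^ (-(1 : ℝ) / 4) := by rw [← h2]; exact h1
      _ ≤ (n : ℝ) ^ (-(1 : ℝ) / 4) / (1 / 2) := div_le_div_of_nonneg_left h4 (by norm_num) h3
      _ = 2 * (n : ℝ) ^ (-(1 : ℝ) / 4) := by ring
  have hrat : (bridgeCount (d + 2) (M + 2) : ℝ) / bridgeCount (d + 2) M ≤
      μ ^ 2 * (1 + 2 * K * (n : ℝ) ^ (-(1 : ℝ) / 4)) := by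
    calc (bridgeCount (d + 2) (M + 2) : ℝ) / bridgeCount (d + 2) M
        ≤ μ ^ 2 * (1 + K * (M : ℝ) ^ (-(1 : ℝ) / 4)) := hU M hMN
      _ ≤ μ ^ 2 * (1 + K * (2 * (n : ℝ) ^ (-(1 : ℝ) / 4))) := by gcongr
      _ = μ ^ 2 * (1 + 2 * K * (n : ℝ) ^ (-(1 : ℝ) / 4)) := by ring
  have hb2 : (bridgeCount (d + 2) (M + 2) : ℝ) ≤
      μ ^ 2 * (1 + 2 * K * (n : ℝ) ^ (-(1 : ℝ) / 4)) * bridgeCount (d + 2) M := by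
    rwa [div_le_iff₀ hbM] at hrat
  unfold renewalA
  rw [div_le_iff₀ (pow_pos hμ _), pow_add, show (1 + 2 * K * (n : ℝ) ^ (-(1 : ℝ) / 4)) *
    ((bridgeCount (d + 2) M : ℝ) / μ ^ M) * (μ ^ M * μ ^ 2) =
    μ ^ 2 * (1 + 2 * K * (n : ℝ) ^ (-(1 : ℝ) / 4)) * bridgeCount (d + 2) M by
      field_simp]
  exact hb2

/-- Elementary: for `y ≥ 2`, `4y + 2 ≤ y^8`. [folklore] -/
private theorem four_mul_add_two_le_pow_eight {y : ℝ} (hy : 2 ≤ y) : 4 * y + 2 ≤ y ^ 8 := by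
  have h7 : (2 : ℝ) ^ 7 ≤ y ^ 7 := pow_le_pow_left₀ (by norm_num) hy 7
  have hy0 : 0 ≤ y := by linarith
  have : y ^ 8 = y * y ^ 7 := by ring
  nlinarith

/-- **Eventual form with the constant read off.** From the upper two-step rate with constant
`K ≥ 0` beyond `N₀`: there is `N₂` with
`|b_n/b_{n−1} − μ| ≤ μ(128μ + 64μK + 64K)/log n` for all `n ≥ N₂`
(`T = ⌊n^{1/8}⌋`, `η = 2K n^{-1/4}`, dropped mass `≤ 32/log n`, `Tη ≤ 16K/log n`, `E_o ≥ 1/μ`).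
[cite: MadrasSlade1993, Theorem 7.3.4 (d) (quantitative form, this file)] -/
theorem ratio_rate_eventually (d : ℕ) {K : ℝ} {N₀ : ℕ} (hK : 0 ≤ K)
    (hU : BridgeTwoStepUpperRate d K N₀) :
    ∃ N₂ : ℕ, ∀ n : ℕ, N₂ ≤ n →
      |(bridgeCount (d + 2) n : ℝ) / bridgeCount (d + 2) (n - 1) - connectiveConstant (d + 2)| ≤
        connectiveConstant (d + 2) * (128 * connectiveConstant (d + 2) +
          64 * connectiveConstant (d + 2) * K + 64 * K) / Real.log n := by
  set μ := connectiveConstant (d + 2) with hμdef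
  have hμ : 0 < μ := connectiveConstant_pos (d + 2)
  have hμ1 : 1 ≤ μ := one_le_connectiveConstant (d + 2)
  -- thresholds: `n^{1/8} ≥ Y₀ := max 2 (max (4K) (μ^2))` and `n ≥ 2 N₀`
  set Y₀ : ℝ := max 2 (max (4 * K) (μ ^ 2)) with hY₀
  have hev1 : ∀ᶠ n : ℕ in atTop, Y₀ ≤ (n : ℝ) ^ ((1 : ℝ) / 8) :=
    ((tendsto_rpow_atTop (by norm_num : (0 : ℝ) < 1 / 8)).comp tendsto_natCast_atTop_atTop).eventually_ge_atTop Y₀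
  have hev2 : ∀ᶠ n : ℕ in atTop, 2 * N₀ ≤ n := eventually_ge_atTop _
  obtain ⟨N₂, hN₂⟩ := eventually_atTop.1 (hev1.and hev2)
  refine ⟨N₂, fun n hn => ?_⟩
  obtain ⟨hy, hN0⟩ := hN₂ n hn
  set y : ℝ := (n : ℝ) ^ ((1 : ℝ) / 8) with hydef
  have hy2 : 2 ≤ y := le_trans (le_max_left _ _) hy
  have hyK : 4 * K ≤ y := le_trans (le_trans (le_max_left _ _) (le_max_right _ _)) hy
  have hyμ : μ ^ 2 ≤ y := le_trans (le_trans (le_max_right _ _) (le_max_right _ _)) hy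
  have hy0 : 0 < y := by linarith
  have hn0' : (0 : ℝ) ≤ n := Nat.cast_nonneg n
  have hn_eq : (n : ℝ) = y ^ 8 := by
    rw [hydef, show ((1 : ℝ) / 8) = ((8 : ℕ) : ℝ)⁻¹ by norm_num, Real.rpow_inv_natCast_pow hn0' (by norm_num)]
  have hn256 : (256 : ℝ) ≤ n := by
    rw [hn_eq]; nlinarith [pow_le_pow_left₀ (by norm_num : (0:ℝ) ≤ 2) hy2 8]
  have hn2 : 2 ≤ n := by exact_mod_cast (show (2 : ℝ) ≤ n by linarith)
  have hn0 : (0 : ℝ) < n := by exact_mod_cast (show 0 < n by omega)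
  have hlogn : 0 < Real.log n := Real.log_pos (by exact_mod_cast (show 1 < n by omega))
  -- `T = ⌊y⌋`
  set T : ℕ := ⌊y⌋₊ with hTdef
  have hT1 : 1 ≤ T := (Nat.one_le_floor_iff y).2 (by linarith)
  have hTy : (T : ℝ) ≤ y := Nat.floor_le hy0.le
  have hyT : y < T + 1 := Nat.lt_floor_add_one y
  have hwinR : (2 * (2 * T + 1) : ℝ) ≤ n := by
    rw [hn_eq]; have := four_mul_add_two_le_pow_eight hy2; linarith
  have hwin : 2 * (2 * T + 1) ≤ n := by exact_mod_cast hwinR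
  have hT : 2 * T + 1 ≤ n := by omega
  -- `η = 2K n^{-1/4} = 2K / y^2`
  set η : ℝ := 2 * K * (n : ℝ) ^ (-(1 : ℝ) / 4) with hηdef
  have hnq : (n : ℝ) ^ (-(1 : ℝ) / 4) = (y ^ 2)⁻¹ := by
    rw [show (-(1 : ℝ) / 4) = ((1 : ℝ) / 8) * (-2) by norm_num, Real.rpow_mul hn0', ← hydef,
      Real.rpow_neg hy0.le, Real.rpow_two]
  have hη0 : 0 ≤ η := by rw [hηdef]; exact mul_nonneg (by linarith) (Real.rpow_nonneg hn0' _)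
  have hηy : η = 2 * K / y ^ 2 := by rw [hηdef, hnq, div_eq_mul_inv]
  have hTη' : (T : ℝ) * η ≤ 2 * K / y := by
    rw [hηy]
    have : (T : ℝ) * (2 * K / y ^ 2) ≤ y * (2 * K / y ^ 2) :=
      mul_le_mul_of_nonneg_right hTy (by positivity)
    calc (T : ℝ) * (2 * K / y ^ 2) ≤ y * (2 * K / y ^ 2) := this
      _ = 2 * K / y := by field_simp
  have hTη : (T : ℝ) * η ≤ 1 / 2 := by
    refine hTη'.trans ?_
    rw [div_le_iff₀ hy0]; linarith
  -- the sandwich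
  have hS := _root_.Literature.Probability.Process.Renewal.ratio_sandwich (renewalA (d + 2)) (renewalP (d + 2)) n T η hT1 hT hη0 hTη
    (fun k => (renewalA_pos (d + 2) k).le) (renewalP_nonneg (d + 2)) (renewalA_pos (d + 2) n) (renewalA_pos (d + 2) (n - 1))
    (lt_of_lt_of_le (inv_pos.2 hμ) (inv_le_renewalP_one (d + 2))) (sum_renewalP_le_one (d + 2) _)
    (renewalA_eq_sum (d + 2)) (hup_bridges d hK hU hwin hN0)
  -- `E_o ≥ 1/μ`
  have hEo : μ⁻¹ ≤ ∑ t ∈ range T, renewalP (d + 2) (2 * t + 1) := by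
    have h1 : renewalP (d + 2) (2 * 0 + 1) ≤ ∑ t ∈ range T, renewalP (d + 2) (2 * t + 1) :=
      Finset.single_le_sum (f := fun t => renewalP (d + 2) (2 * t + 1)) (fun t _ => renewalP_nonneg (d + 2) _)
        (Finset.mem_range.2 (by omega))
    exact le_trans (inv_le_renewalP_one (d + 2)) (by simpa using h1)
  have hEo_pos : 0 < ∑ t ∈ range T, renewalP (d + 2) (2 * t + 1) := lt_of_lt_of_le (inv_pos.2 hμ) hEo
  -- dropped mass `ε ≤ 32 / log n`
  have h2T1 : 1 ≤ 2 * T := by omega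
  have hy2T : y ≤ (2 * T : ℕ) := by push_cast; linarith
  have hμ2T : μ ≤ (2 * T : ℕ) := by nlinarith
  have hε1 := kestenTail_le_inv_log (d + 2) h2T1 hμ2T
  have hL : Real.log n / 16 ≤ Real.log (((2 * T : ℕ) : ℝ) / μ) := by
    have h1 : Real.log (y / μ) ≤ Real.log (((2 * T : ℕ) : ℝ) / μ) :=
      Real.log_le_log (by positivity) (div_le_div_of_nonneg_right hy2T hμ.le)
    have h2 : Real.log (y / μ) = Real.log y - Real.log μ := Real.log_div hy0.ne' hμ.ne'
    have h3 : Real.log y = (1 : ℝ) / 8 * Real.log n := by rw [hydef, Real.log_rpow hn0]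
    have h4 : 2 * Real.log μ ≤ Real.log y := by
      have : Real.log (μ ^ 2) = 2 * Real.log μ := by
        rw [Real.log_pow]; norm_num
      rw [← this]; exact Real.log_le_log (by positivity) hyμ
    linarith
  have hLpos : 0 < Real.log (((2 * T : ℕ) : ℝ) / μ) := lt_of_lt_of_le (by linarith) hL
  have hε : 1 - ∑ k ∈ Icc 1 (2 * T), renewalP (d + 2) k ≤ 32 / Real.log n := by
    refine hε1.trans ?_
    calc 1 / (1 + Real.log (((2 * T : ℕ) : ℝ) / μ) / 2)
        ≤ 1 / (Real.log (((2 * T : ℕ) : ℝ) / μ) / 2) :=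
          one_div_le_one_div_of_le (by linarith) (by linarith)
      _ ≤ 1 / (Real.log n / 32) := one_div_le_one_div_of_le (by positivity) (by linarith)
      _ = 32 / Real.log n := by rw [one_div_div]
  -- `Tη ≤ 16K / log n` via `log n ≤ 8 y`
  have hlog8 : Real.log n ≤ 8 * y := by
    have := Real.log_le_rpow_div hn0' (by norm_num : (0 : ℝ) < 1 / 8)
    rw [← hydef] at this; linarith
  have hTηlog : (T : ℝ) * η ≤ 16 * K / Real.log n := by
    refine hTη'.trans ?_
    rw [div_le_div_iff₀ hy0 hlogn]
    nlinarith
  -- assemble `|a_n/a_{n-1} − 1| ≤ K₁ / log n`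
  have hfrac : ((1 - ∑ k ∈ Icc 1 (2 * T), renewalP (d + 2) k) + T * η) / (∑ t ∈ range T, renewalP (d + 2) (2 * t + 1)) ≤
      μ * ((32 + 16 * K) / Real.log n) := by
    have hnum0 : 0 ≤ (1 - ∑ k ∈ Icc 1 (2 * T), renewalP (d + 2) k) + T * η := by
      have := sum_renewalP_le_one (d + 2) (Icc 1 (2 * T))
      have := mul_nonneg (Nat.cast_nonneg T) hη0
      linarith
    calc ((1 - ∑ k ∈ Icc 1 (2 * T), renewalP (d + 2) k) + T * η) / (∑ t ∈ range T, renewalP (d + 2) (2 * t + 1))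
        ≤ ((1 - ∑ k ∈ Icc 1 (2 * T), renewalP (d + 2) k) + T * η) / μ⁻¹ :=
          div_le_div_of_nonneg_left hnum0 (inv_pos.2 hμ) hEo
      _ = μ * ((1 - ∑ k ∈ Icc 1 (2 * T), renewalP (d + 2) k) + T * η) := by rw [div_inv_eq_mul, mul_comm]
      _ ≤ μ * (32 / Real.log n + 16 * K / Real.log n) := by gcongr
      _ = μ * ((32 + 16 * K) / Real.log n) := by ring
  have hA : |renewalA (d + 2) n / renewalA (d + 2) (n - 1) - 1| ≤
      (128 * μ + 64 * μ * K + 64 * K) / Real.log n := by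
    refine hS.trans ?_
    have : 4 * (μ * ((32 + 16 * K) / Real.log n) + 16 * K / Real.log n) =
        (128 * μ + 64 * μ * K + 64 * K) / Real.log n := by
      field_simp; ring
    rw [← this]; gcongr
  -- convert to `b_n / b_{n-1}`
  have hconv : (bridgeCount (d + 2) n : ℝ) / bridgeCount (d + 2) (n - 1) - μ =
      μ * (renewalA (d + 2) n / renewalA (d + 2) (n - 1) - 1) := by
    have hb1 : (0 : ℝ) < bridgeCount (d + 2) (n - 1) := by
      exact_mod_cast one_le_bridgeCount (d := d + 2) (n - 1)
    obtain ⟨n', hn'⟩ : ∃ n', n = n' + 1 := ⟨n - 1, by omega⟩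
    subst hn'
    have hb0 : (0 : ℝ) < bridgeCount (d + 2) n' := by
      exact_mod_cast one_le_bridgeCount (d := d + 2) n'
    have haB : renewalA (d + 2) (n' + 1) / renewalA (d + 2) (n' + 1 - 1) =
        (bridgeCount (d + 2) (n' + 1) : ℝ) / (μ * bridgeCount (d + 2) n') := by
      simp only [renewalA, Nat.add_sub_cancel]
      rw [← hμdef, pow_succ]
      field_simp
    rw [haB, Nat.add_sub_cancel]
    field_simp
  rw [hconv, abs_mul, abs_of_pos hμ, mul_div_assoc]
  exact mul_le_mul_of_nonneg_left hA hμ.le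

/-- **The rate, from an upper two-step rate**: an upper two-step rate `b_{N+2}/b_N ≤ μ²(1 + K' N^{-1/4})`
(`N ≥ N₀`) implies a RATE for Madras–Slade Thm 7.3.4(d): `∃ K, ∀ N ≥ 2, |b_{N+1}/b_N − μ| ≤ K/log N`
(every `d ≥ 2`; the finitely many `N` below the threshold are absorbed into `K`).
[cite: MadrasSlade1993, Theorem 7.3.4 (d) (quantitative form, this file)] -/
theorem bridgeRatio_rate_log_of_upperRate (d : ℕ)
    (hU : ∃ K' : ℝ, ∃ N₀ : ℕ, BridgeTwoStepUpperRate d K' N₀) :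
    ∃ K : ℝ, ∀ N : ℕ, 2 ≤ N →
      |(bridgeCount (d + 2) (N + 1) : ℝ) / bridgeCount (d + 2) N - connectiveConstant (d + 2)| ≤
        K / Real.log N := by
  obtain ⟨K', N₀, hU⟩ := hU
  set μ := connectiveConstant (d + 2) with hμdef
  have hμ : 0 < μ := connectiveConstant_pos (d + 2)
  have hU' : BridgeTwoStepUpperRate d (max K' 0) N₀ := upperRate_mono hU (le_max_left _ _)
  have hK0 : 0 ≤ max K' 0 := le_max_right _ _
  obtain ⟨N₂, hN₂⟩ := ratio_rate_eventually d hK0 hU'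
  set K₁ : ℝ := μ * (128 * μ + 64 * μ * max K' 0 + 64 * max K' 0) with hK₁
  have hK₁0 : 0 ≤ K₁ := by positivity
  -- the finite patch
  set g : ℕ → ℝ := fun N =>
    |(bridgeCount (d + 2) (N + 1) : ℝ) / bridgeCount (d + 2) N - μ| * Real.log N with hg
  have hg0 : ∀ N, 0 ≤ g N := fun N =>
    mul_nonneg (abs_nonneg _) (Real.log_natCast_nonneg N)
  set S : ℝ := ∑ N ∈ range N₂, g N with hS
  have hS0 : 0 ≤ S := Finset.sum_nonneg fun N _ => hg0 N
  refine ⟨K₁ + S, fun N hN => ?_⟩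
  have hlogN : 0 < Real.log N := Real.log_pos (by exact_mod_cast (show 1 < N by omega))
  by_cases hcase : N₂ ≤ N + 1
  · -- asymptotic regime
    have h := hN₂ (N + 1) hcase
    rw [Nat.add_sub_cancel] at h
    have hlog_le : Real.log N ≤ Real.log ((N + 1 : ℕ) : ℝ) :=
      Real.log_le_log (by exact_mod_cast (show 0 < N by omega)) (by exact_mod_cast (show N ≤ N + 1 by omega))
    calc |(bridgeCount (d + 2) (N + 1) : ℝ) / bridgeCount (d + 2) N - μ|
        ≤ K₁ / Real.log ((N + 1 : ℕ) : ℝ) := h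
      _ ≤ K₁ / Real.log N := div_le_div_of_nonneg_left hK₁0 hlogN hlog_le
      _ ≤ (K₁ + S) / Real.log N := by gcongr; linarith
  · -- finite regime: `N < N₂`
    have hmem : N ∈ range N₂ := Finset.mem_range.2 (by omega)
    have hle : g N ≤ S := Finset.single_le_sum (fun M _ => hg0 M) hmem
    have h1 : |(bridgeCount (d + 2) (N + 1) : ℝ) / bridgeCount (d + 2) N - μ| ≤ S / Real.log N := by
      rw [le_div_iff₀ hlogN]; exact hle
    calc |(bridgeCount (d + 2) (N + 1) : ℝ) / bridgeCount (d + 2) N - μ|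
        ≤ S / Real.log N := h1
      _ ≤ (K₁ + S) / Real.log N := by gcongr; linarith

/-- The same from the two-sided shape `BridgeTwoStepRate`.
[cite: MadrasSlade1993, Theorem 7.3.4 (d) (quantitative form, this file)] -/
theorem bridgeRatio_rate_log_of_rate (d : ℕ) (hR : ∃ K : ℝ, ∃ N₀ : ℕ, BridgeTwoStepRate d K N₀) :
    ∃ K : ℝ, ∀ N : ℕ, 2 ≤ N →
      |(bridgeCount (d + 2) (N + 1) : ℝ) / bridgeCount (d + 2) N - connectiveConstant (d + 2)| ≤
        K / Real.log N := by
  obtain ⟨K, N₀, h⟩ := hR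
  exact bridgeRatio_rate_log_of_upperRate d ⟨_, N₀, upperRate_of_rate h⟩

/-! ### The unconditional rate for Theorem 7.3.4 (d) -/

/-- **A RATE for Madras–Slade Theorem 7.3.4 (d), unconditional, every dimension `d + 2 ≥ 2`:**
`∃ K, ∀ N ≥ 2, |b_{N+1}/b_N − μ| ≤ K / log N`. The printed theorem (`MadrasSlade1993_thm734d`) is the
limit `b_{N+1}/b_N → μ` with no rate; the input rate for the two-step ratio is
`exists_bridgeTwoStepRate` (`SAWBridgeTwoStepRate.lean`) (Kesten's pattern-theorem mechanism for bridges), the conversion is the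
renewal sandwich of §1 with the explicit Kesten tail of §2.
[cite: MadrasSlade1993, Theorem 7.3.4 (d); §7.5 eq. (7.5.1)–(7.5.2) (Kesten's rates, for comparison)] -/
theorem bridgeRatio_rate_log (d : ℕ) :
    ∃ K : ℝ, ∀ N : ℕ, 2 ≤ N →
      |(bridgeCount (d + 2) (N + 1) : ℝ) / bridgeCount (d + 2) N - connectiveConstant (d + 2)| ≤
        K / Real.log N := by
  obtain ⟨K, _, N₀, h⟩ := exists_bridgeTwoStepRate d
  exact bridgeRatio_rate_log_of_rate d ⟨K, N₀, h⟩

/-- **The rate with the constant read off** (unconditional): with the upper two-step constant `K' ≥ 0` and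
threshold `N₀` of `exists_bridgeTwoStepUpperRate`, `|b_n/b_{n−1} − μ| ≤ μ(128μ + 64μK' + 64K')/log n` for all
large `n`.
[cite: MadrasSlade1993, Theorem 7.3.4 (d) (quantitative form, this file)] -/
theorem bridgeRatio_rate_log_eventually (d : ℕ) :
    ∃ K' : ℝ, 0 ≤ K' ∧ ∃ N₂ : ℕ, ∀ n : ℕ, N₂ ≤ n →
      |(bridgeCount (d + 2) n : ℝ) / bridgeCount (d + 2) (n - 1) - connectiveConstant (d + 2)| ≤
        connectiveConstant (d + 2) * (128 * connectiveConstant (d + 2) +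
          64 * connectiveConstant (d + 2) * K' + 64 * K') / Real.log n := by
  obtain ⟨K', hK', N₀, h⟩ := exists_bridgeTwoStepUpperRate d
  exact ⟨K', hK', ratio_rate_eventually d hK' h⟩

/-! ### The sharp-constant form: `lim sup (log N)·|b_{N+1}/b_N − μ| ≤ 2μ/(αE)` -/

/-- Per-index core bound with a free window length `T`: for `T ≥ 1`, `2(2T+1) ≤ n`, `2N₀ ≤ n`, `μ ≤ 2T`,
`η = 2K n^{-1/4}` with `Tη ≤ 1/2`:
`|b_n/b_{n−1} − μ| ≤ μ · (1/(1+½log(2T/μ)) + Tη)/((1−Tη)·E_o^{(T)})`, `E_o^{(T)} = Σ_{t<T} λ_{2t+1}μ^{-(2t+1)}`.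
[cite: MadrasSlade1993, Theorem 7.3.4 (d) (proof, eq. (7.3.14), quantitative form)] -/
theorem ratio_bound_core (d : ℕ) {K : ℝ} {N₀ : ℕ} (hK : 0 ≤ K) (hU : BridgeTwoStepUpperRate d K N₀)
    {n T : ℕ} (hT1 : 1 ≤ T) (hwin : 2 * (2 * T + 1) ≤ n) (hN₀ : 2 * N₀ ≤ n)
    (hμT : connectiveConstant (d + 2) ≤ ((2 * T : ℕ) : ℝ))
    (hTη : (T : ℝ) * (2 * K * (n : ℝ) ^ (-(1 : ℝ) / 4)) ≤ 1 / 2) :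
    |(bridgeCount (d + 2) n : ℝ) / bridgeCount (d + 2) (n - 1) - connectiveConstant (d + 2)| ≤
      connectiveConstant (d + 2) *
        (((1 / (1 + Real.log (((2 * T : ℕ) : ℝ) / connectiveConstant (d + 2)) / 2)) +
            T * (2 * K * (n : ℝ) ^ (-(1 : ℝ) / 4))) /
          ((1 - T * (2 * K * (n : ℝ) ^ (-(1 : ℝ) / 4))) * ∑ t ∈ range T, renewalP (d + 2) (2 * t + 1))) := by
  set μ := connectiveConstant (d + 2) with hμdef
  have hμ : 0 < μ := connectiveConstant_pos (d + 2)
  set η : ℝ := 2 * K * (n : ℝ) ^ (-(1 : ℝ) / 4) with hηdef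
  have hn0' : (0 : ℝ) ≤ n := Nat.cast_nonneg n
  have hη0 : 0 ≤ η := by rw [hηdef]; exact mul_nonneg (by linarith) (Real.rpow_nonneg hn0' _)
  have hT : 2 * T + 1 ≤ n := by omega
  have hS := _root_.Literature.Probability.Process.Renewal.ratio_sandwich_sharp (renewalA (d + 2)) (renewalP (d + 2)) n T η hT1 hT hη0 hTη
    (fun k => (renewalA_pos (d + 2) k).le) (renewalP_nonneg (d + 2)) (renewalA_pos (d + 2) n) (renewalA_pos (d + 2) (n - 1))
    (lt_of_lt_of_le (inv_pos.2 hμ) (inv_le_renewalP_one (d + 2))) (sum_renewalP_le_one (d + 2) _)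
    (renewalA_eq_sum (d + 2)) (hup_bridges d hK hU hwin hN₀)
  set Eo := ∑ t ∈ range T, renewalP (d + 2) (2 * t + 1) with hEo
  have hEo_pos : 0 < Eo := by
    have h1 : renewalP (d + 2) (2 * 0 + 1) ≤ Eo :=
      Finset.single_le_sum (f := fun t => renewalP (d + 2) (2 * t + 1)) (fun t _ => renewalP_nonneg (d + 2) _)
        (Finset.mem_range.2 (by omega))
    have h2 := lt_of_lt_of_le (inv_pos.2 hμ) (inv_le_renewalP_one (d + 2))
    exact lt_of_lt_of_le h2 (by simpa using h1)
  have hθ : 0 < 1 - (T : ℝ) * η := by linarith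
  have hden : 0 < (1 - (T : ℝ) * η) * Eo := mul_pos hθ hEo_pos
  -- replace the dropped mass by the explicit Kesten tail
  have h2T1 : 1 ≤ 2 * T := by omega
  have hε := kestenTail_le_inv_log (d + 2) h2T1 hμT
  have hS' : |renewalA (d + 2) n / renewalA (d + 2) (n - 1) - 1| ≤
      ((1 / (1 + Real.log (((2 * T : ℕ) : ℝ) / μ) / 2)) + T * η) / ((1 - T * η) * Eo) := by
    refine hS.trans (div_le_div_of_nonneg_right ?_ hden.le)
    have : 1 - ∑ k ∈ Icc 1 (2 * T), renewalP (d + 2) k ≤ 1 / (1 + Real.log (((2 * T : ℕ) : ℝ) / μ) / 2) := hε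
    linarith
  -- convert to `b_n / b_{n-1}`
  have hconv : (bridgeCount (d + 2) n : ℝ) / bridgeCount (d + 2) (n - 1) - μ =
      μ * (renewalA (d + 2) n / renewalA (d + 2) (n - 1) - 1) := by
    obtain ⟨n', hn'⟩ : ∃ n', n = n' + 1 := ⟨n - 1, by omega⟩
    subst hn'
    have hb0 : (0 : ℝ) < bridgeCount (d + 2) n' := by
      exact_mod_cast one_le_bridgeCount (d := d + 2) n'
    have haB : renewalA (d + 2) (n' + 1) / renewalA (d + 2) (n' + 1 - 1) =
        (bridgeCount (d + 2) (n' + 1) : ℝ) / (μ * bridgeCount (d + 2) n') := by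
      simp only [renewalA, Nat.add_sub_cancel]
      rw [← hμdef, pow_succ]
      field_simp
    rw [haB, Nat.add_sub_cancel]
    field_simp
  rw [hconv, abs_mul, abs_of_pos hμ]
  exact mul_le_mul_of_nonneg_left hS' hμ.le

/-- Elementary: for `z ≥ 2`, `4z + 2 ≤ z^4`. [folklore] -/
private theorem four_mul_add_two_le_pow_four {z : ℝ} (hz : 2 ≤ z) : 4 * z + 2 ≤ z ^ 4 := by
  have h3 : (2 : ℝ) ^ 3 ≤ z ^ 3 := pow_le_pow_left₀ (by norm_num) hz 3
  have : z ^ 4 = z * z ^ 3 := by ring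
  nlinarith

/-- **Sharp-constant form (unconditional, every `d + 2 ≥ 2`)**: for every `α ∈ (0, 1/4)`,
`δ > 0` and `T₀ ≥ 1`, eventually in `N`,
`|b_{N+1}/b_N − μ| ≤ (2μ/(α E) + δ)/log N`, `E = Σ_{t<T₀} λ_{2t+1} μ^{-(2t+1)}` (any odd partial sum
of Kesten's masses — the FINITE-DATA constant; `λ₁ = 1, λ₃ = 2` on `ℤ²` give `E ≥ 1/μ + 2/μ³`). The
leading constant is free of the pattern-theorem constant of the two-step rate, which only enters the
threshold.
[cite: MadrasSlade1993, Theorem 7.3.4 (d) (proof, eq. (7.3.14): E_o, E_e)] -/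
theorem bridgeRatio_rate_limsup (d T₀ : ℕ) (hT₀ : 1 ≤ T₀) {α : ℝ} (hα0 : 0 < α) (hα : α < 1 / 4)
    {δ : ℝ} (hδ : 0 < δ) :
    ∀ᶠ N : ℕ in atTop,
      |(bridgeCount (d + 2) (N + 1) : ℝ) / bridgeCount (d + 2) N - connectiveConstant (d + 2)| ≤
        (2 * connectiveConstant (d + 2) /
            (α * ∑ t ∈ range T₀, (irreducibleBridgeCount (d + 2) (2 * t + 1) : ℝ) /
              connectiveConstant (d + 2) ^ (2 * t + 1)) + δ) / Real.log N := by
  obtain ⟨K, hK, N₀, hU⟩ := exists_bridgeTwoStepUpperRate d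
  set μ := connectiveConstant (d + 2) with hμdef
  have hμ : 0 < μ := connectiveConstant_pos (d + 2)
  have hμ1 : 1 ≤ μ := one_le_connectiveConstant (d + 2)
  -- the finite-data constant `E = Σ_{t<T₀} p_{2t+1} > 0`
  set E := ∑ t ∈ range T₀, renewalP (d + 2) (2 * t + 1) with hE
  have hEeq : ∑ t ∈ range T₀, (irreducibleBridgeCount (d + 2) (2 * t + 1) : ℝ) / μ ^ (2 * t + 1) = E := by
    rw [hE]; rfl
  have hE_pos : 0 < E := by
    have h1 : renewalP (d + 2) (2 * 0 + 1) ≤ E :=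
      Finset.single_le_sum (f := fun t => renewalP (d + 2) (2 * t + 1)) (fun t _ => renewalP_nonneg (d + 2) _)
        (Finset.mem_range.2 (by omega))
    exact lt_of_lt_of_le (lt_of_lt_of_le (inv_pos.2 hμ) (inv_le_renewalP_one (d + 2))) (by simpa using h1)
  set C : ℝ := 2 * μ / (α * E) with hC
  have hr : 0 < 1 / 4 - α := by linarith
  -- the comparison functions
  set L : ℕ → ℝ := fun n => Real.log n with hL
  set k : ℕ → ℝ := fun n => 2 * K * (n : ℝ) ^ (-(1 / 4 - α)) with hk
  set g : ℕ → ℝ := fun n => 2 * L n / (2 + α * L n - 2 * Real.log μ) with hg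
  set h : ℕ → ℝ := fun n => 2 * K * (Real.log n / (n : ℝ) ^ (1 / 4 - α)) with hh
  set R : ℕ → ℝ := fun n => μ * (g n + h n) / ((1 - k n) * E) with hR
  -- limits
  have hLlim : Tendsto L atTop atTop := Real.tendsto_log_atTop.comp tendsto_natCast_atTop_atTop
  have hklim : Tendsto k atTop (𝓝 0) := by
    have := ((tendsto_rpow_neg_atTop hr).comp tendsto_natCast_atTop_atTop).const_mul (2 * K)
    simpa [hk] using this
  have hhlim : Tendsto h atTop (𝓝 0) := by
    have h1 := ((isLittleO_log_rpow_atTop hr).tendsto_div_nhds_zero).comp tendsto_natCast_atTop_atTop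
    have := h1.const_mul (2 * K)
    simpa [hh] using this
  have hglim : Tendsto g atTop (𝓝 (2 / α)) := by
    have h1 : Tendsto (fun n => (2 - 2 * Real.log μ) / L n) atTop (𝓝 0) :=
      tendsto_const_nhds.div_atTop hLlim
    have h2 : Tendsto (fun n => 2 / (α + (2 - 2 * Real.log μ) / L n)) atTop (𝓝 (2 / α)) := by
      have : Tendsto (fun n => α + (2 - 2 * Real.log μ) / L n) atTop (𝓝 (α + 0)) :=
        tendsto_const_nhds.add h1
      rw [add_zero] at this
      exact tendsto_const_nhds.div this hα0.ne'
    refine h2.congr' ?_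
    have hev1 : ∀ᶠ n : ℕ in atTop, 1 < L n := hLlim.eventually_gt_atTop 1
    have hev2 : ∀ᶠ n : ℕ in atTop, 2 * Real.log μ / α < L n := hLlim.eventually_gt_atTop _
    filter_upwards [hev1, hev2] with n hn hn2
    have hLn : L n ≠ 0 := by linarith
    have hn2' : 2 * Real.log μ < α * L n := by rw [div_lt_iff₀ hα0] at hn2; linarith
    have hD : 2 + α * L n - 2 * Real.log μ ≠ 0 := by linarith
    rw [hg]
    simp only
    rw [show α + (2 - 2 * Real.log μ) / L n = (2 + α * L n - 2 * Real.log μ) / L n by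
      field_simp; ring, div_div_eq_mul_div]
  have hRlim : Tendsto R atTop (𝓝 C) := by
    have h1 : Tendsto (fun n => μ * (g n + h n)) atTop (𝓝 (μ * (2 / α + 0))) :=
      (hglim.add hhlim).const_mul μ
    have h2 : Tendsto (fun n => (1 - k n) * E) atTop (𝓝 ((1 - 0) * E)) :=
      (tendsto_const_nhds.sub hklim).mul_const E
    have h3 := h1.div h2 (by simpa using hE_pos.ne')
    have hCe : μ * (2 / α + 0) / ((1 - 0) * E) = C := by
      rw [hC, add_zero, sub_zero, one_mul]; field_simp
    rw [hCe] at h3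
    exact h3
  -- eventual side conditions (in the shifted index `n = N + 1`)
  have F1 : ∀ᶠ n : ℕ in atTop, max 2 (max μ (T₀ : ℝ)) ≤ (n : ℝ) ^ α :=
    ((tendsto_rpow_atTop hα0).comp tendsto_natCast_atTop_atTop).eventually_ge_atTop _
  have F2 : ∀ᶠ n : ℕ in atTop, (2 : ℝ) ≤ (n : ℝ) ^ ((1 : ℝ) / 4) :=
    ((tendsto_rpow_atTop (by norm_num : (0 : ℝ) < 1 / 4)).comp tendsto_natCast_atTop_atTop).eventually_ge_atTop _
  have F3 : ∀ᶠ n : ℕ in atTop, 2 * N₀ ≤ n := eventually_ge_atTop _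
  have F4 : ∀ᶠ n : ℕ in atTop, k n < 1 / 2 := (tendsto_order.1 hklim).2 _ (by norm_num)
  have F5 : ∀ᶠ n : ℕ in atTop, 2 * Real.log μ < α * L n := by
    have := hLlim.eventually_gt_atTop (2 * Real.log μ / α)
    filter_upwards [this] with n hn
    rw [div_lt_iff₀ hα0] at hn; linarith
  have F6 : ∀ᶠ n : ℕ in atTop, R n < C + δ := (tendsto_order.1 hRlim).2 _ (by linarith)
  have F7 : ∀ᶠ n : ℕ in atTop, 2 ≤ n := eventually_ge_atTop 2
  have hall : ∀ᶠ n : ℕ in atTop,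
      |(bridgeCount (d + 2) n : ℝ) / bridgeCount (d + 2) (n - 1) - μ| ≤ (C + δ) / Real.log n := by
    filter_upwards [F1, F2, F3, F4, F5, F6, F7] with n hy hz hN0 hkn hLμ hRn hn2
    have hn0 : (0 : ℝ) < n := by exact_mod_cast (show 0 < n by omega)
    have hn0' : (0 : ℝ) ≤ n := hn0.le
    have hlogn : 0 < Real.log n := Real.log_pos (by exact_mod_cast (show 1 < n by omega))
    have hlogμ : 0 ≤ Real.log μ := Real.log_nonneg hμ1
    have hLμ' : 2 * Real.log μ < α * Real.log n := hLμ
    set y : ℝ := (n : ℝ) ^ α with hydef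
    set z : ℝ := (n : ℝ) ^ ((1 : ℝ) / 4) with hzdef
    have hy2 : 2 ≤ y := le_trans (le_max_left _ _) hy
    have hyμ : μ ≤ y := le_trans (le_trans (le_max_left _ _) (le_max_right _ _)) hy
    have hyT₀ : (T₀ : ℝ) ≤ y := le_trans (le_trans (le_max_right _ _) (le_max_right _ _)) hy
    have hy0 : 0 < y := by linarith
    have hyz : y ≤ z := Real.rpow_le_rpow_of_exponent_le (by exact_mod_cast (show 1 ≤ n by omega)) hα.le
    have hn_eq : (n : ℝ) = z ^ 4 := by
      rw [hzdef, show ((1 : ℝ) / 4) = ((4 : ℕ) : ℝ)⁻¹ by norm_num, Real.rpow_inv_natCast_pow hn0' (by norm_num)]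
    -- `T = ⌊y⌋`
    set T : ℕ := ⌊y⌋₊ with hTdef
    have hT1 : 1 ≤ T := (Nat.one_le_floor_iff y).2 (by linarith)
    have hTy : (T : ℝ) ≤ y := Nat.floor_le hy0.le
    have hyT : y < T + 1 := Nat.lt_floor_add_one y
    have hTT₀ : T₀ ≤ T := Nat.le_floor hyT₀
    have hwinR : (2 * (2 * T + 1) : ℝ) ≤ n := by
      rw [hn_eq]; have := four_mul_add_two_le_pow_four hz; linarith
    have hwin : 2 * (2 * T + 1) ≤ n := by exact_mod_cast hwinR
    have h2Ty : y ≤ ((2 * T : ℕ) : ℝ) := by push_cast; linarith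
    have hμT : μ ≤ ((2 * T : ℕ) : ℝ) := hyμ.trans h2Ty
    -- `η = 2K n^{-1/4}`, `Tη ≤ k n < 1/2`
    set η : ℝ := 2 * K * (n : ℝ) ^ (-(1 : ℝ) / 4) with hηdef
    have hη0 : 0 ≤ η := by rw [hηdef]; exact mul_nonneg (by linarith) (Real.rpow_nonneg hn0' _)
    have hTηk : (T : ℝ) * η ≤ k n := by
      have e1 : y * η = k n := by
        rw [hk, hydef, hηdef]
        simp only
        rw [show -(1 / 4 - α) = α + (-(1 : ℝ) / 4) by ring, Real.rpow_add hn0]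
        ring
      calc (T : ℝ) * η ≤ y * η := mul_le_mul_of_nonneg_right hTy hη0
        _ = k n := e1
    have hTη : (T : ℝ) * η ≤ 1 / 2 := by linarith
    -- the core bound
    have hcore := ratio_bound_core d hK hU hT1 hwin hN0 hμT hTη
    -- compare with `R n / log n`
    set Eo := ∑ t ∈ range T, renewalP (d + 2) (2 * t + 1) with hEo
    have hEoE : E ≤ Eo := by
      rw [hE, hEo]
      exact Finset.sum_le_sum_of_subset_of_nonneg
        (fun t ht => Finset.mem_range.2 (lt_of_lt_of_le (Finset.mem_range.1 ht) hTT₀))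
        (fun t _ _ => renewalP_nonneg (d + 2) _)
    have hθ : 0 < 1 - (T : ℝ) * η := by linarith
    set εb : ℝ := 1 / (1 + Real.log (((2 * T : ℕ) : ℝ) / μ) / 2) with hεb
    -- `εb · log n ≤ g n`
    have hLb : α * Real.log n - Real.log μ ≤ Real.log (((2 * T : ℕ) : ℝ) / μ) := by
      have h1 : Real.log (y / μ) ≤ Real.log (((2 * T : ℕ) : ℝ) / μ) :=
        Real.log_le_log (by positivity) (div_le_div_of_nonneg_right h2Ty hμ.le)
      have h2 : Real.log (y / μ) = Real.log y - Real.log μ := Real.log_div hy0.ne' hμ.ne'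
      have h3 : Real.log y = α * Real.log n := by rw [hydef, Real.log_rpow hn0]
      linarith
    have hD0 : 0 < 2 + α * Real.log n - 2 * Real.log μ := by
      have : L n = Real.log n := rfl
      rw [← this]; linarith
    have hεg : εb * Real.log n ≤ g n := by
      have h1 : εb ≤ 2 / (2 + α * Real.log n - 2 * Real.log μ) := by
        rw [hεb]
        rw [div_le_div_iff₀ (by linarith) hD0]
        linarith
      calc εb * Real.log n ≤ 2 / (2 + α * Real.log n - 2 * Real.log μ) * Real.log n :=
            mul_le_mul_of_nonneg_right h1 hlogn.le
        _ = g n := by rw [hg]; simp only [hL]; ring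
    -- `Tη · log n ≤ h n`
    have hTηh : (T : ℝ) * η * Real.log n ≤ h n := by
      have e1 : k n * Real.log n = h n := by
        rw [hk, hh]; simp only
        rw [Real.rpow_neg hn0', div_eq_mul_inv]; ring
      calc (T : ℝ) * η * Real.log n ≤ k n * Real.log n := mul_le_mul_of_nonneg_right hTηk hlogn.le
        _ = h n := e1
    -- assemble
    have hnum0 : 0 ≤ εb + T * η := by
      have : 0 ≤ εb := by rw [hεb]; exact div_nonneg zero_le_one (by linarith [hLb, hD0])
      have := mul_nonneg (Nat.cast_nonneg T) hη0
      linarith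
    have hstep1 : μ * ((εb + T * η) / ((1 - T * η) * Eo)) ≤ μ * ((εb + T * η) / ((1 - k n) * E)) := by
      refine mul_le_mul_of_nonneg_left ?_ hμ.le
      refine div_le_div_of_nonneg_left hnum0 (mul_pos (by linarith) hE_pos) ?_
      exact mul_le_mul (by linarith) hEoE hE_pos.le hθ.le
    have hstep2 : μ * ((εb + T * η) / ((1 - k n) * E)) * Real.log n ≤ R n := by
      rw [hR]; simp only
      rw [mul_div_assoc, mul_assoc, div_mul_eq_mul_div]
      refine mul_le_mul_of_nonneg_left ?_ hμ.le
      refine div_le_div_of_nonneg_right ?_ (mul_pos (by linarith) hE_pos).le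
      have : (εb + T * η) * Real.log n = εb * Real.log n + T * η * Real.log n := by ring
      rw [this]; exact add_le_add hεg hTηh
    have hfin : μ * ((εb + T * η) / ((1 - T * η) * Eo)) ≤ (C + δ) / Real.log n := by
      rw [le_div_iff₀ hlogn]
      calc μ * ((εb + T * η) / ((1 - T * η) * Eo)) * Real.log n
          ≤ μ * ((εb + T * η) / ((1 - k n) * E)) * Real.log n :=
            mul_le_mul_of_nonneg_right hstep1 hlogn.le
        _ ≤ R n := hstep2
        _ ≤ C + δ := hRn.le
    exact hcore.trans hfin
  -- shift the index: `n = N + 1`, `log N ≤ log (N+1)`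
  have hshift := (tendsto_add_atTop_nat 1).eventually hall
  filter_upwards [hshift, eventually_ge_atTop 2] with N hN hN2
  have hlogN : 0 < Real.log N := Real.log_pos (by exact_mod_cast (show 1 < N by omega))
  have hCδ : 0 ≤ C + δ := by
    have : 0 ≤ C := by rw [hC]; positivity
    linarith
  have hlog_le : Real.log N ≤ Real.log ((N + 1 : ℕ) : ℝ) :=
    Real.log_le_log (by exact_mod_cast (show 0 < N by omega)) (by exact_mod_cast (show N ≤ N + 1 by omega))
  simp only [Nat.add_sub_cancel] at hN
  rw [hEeq, ← hC]
  exact hN.trans (div_le_div_of_nonneg_left hCδ hlogN hlog_le)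


end Literature.Probability.RandomPlanarGeometry.SAW.Zd

end
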